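/-
Copyright (c) 2026 the pub-hodgecm-mathlib formalisation cell (harness21).  Prover seat hodgecm-mathlib-F0P3-p02 (g26), 2026-09-03.  E1 row 47c R-c «JACQUET FUNCTOR OF THE
SCHNEIDER–STUHLER RESOLUTION», FILE 4 «THE EULER IDENTITY OF THE JACQUET MODULE OF A TWO-TERM RESOLUTION BY BLOCK-PERMUTATION MODULES» (census row 47 §2 (A3); plan 02:20:35Z;
over ★ Jacquet exactness `JacquetModuleExactProofs`, ★ 47c FILE 3, ★ 47a′ `SnakeCokernelRank` (LH5-p02)).
-/
import Literature.NumberTheory.Automorphic.JacquetModuleExactProofs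
import Literature.NumberTheory.Automorphic.JacquetModuleBlockPermutation
import Literature.LinearAlgebra.SnakeCokernelRank
import HarnessLib

/-!
# The Euler identity `Σ_{R₀¹} dim W¹_r ⧸ K¹_r = Σ_{S₀} dim W⁰_r ⧸ K⁰_r` for `0 → M₁ → M₀ → V → 0` with `V_N` finite-dimensional

Topic `NumberTheory/Automorphic`; declarations in the `Representation` namespace (deliberate dot-style extension, lean/CONVENTIONS.md §2).  THEOREMS ONLY (no definition, no instance, no
notation, no named fact, no `sorry`).  Cell `pub/hodgecm-mathlib` (D-0151), crux H413 = `stmt-HodgeConjecture-24833`, lane `--supports`; E1 BRICK LEDGER row 47c FILE 4 (= census row 47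
§2 (A3) «`EP_T ≡ 0` on the `B`-side», Ext-free).  HONEST LABEL: count-neutral generic base layer; (R-SS) NOT chartered; E1 = PRINT until the keeper's charter test; HC_CM is proved only
modulo the 2 remaining named inputs (hLiu418 = `stmt-HodgeConjecture-24832`, h413 = `stmt-HodgeConjecture-24833`) until rung 0 closes.

THE MATHEMATICS ([BernsteinZelevinsky1976, §2.3, Prop. 2.35]; [Casselman1995, §3.2, §6.3]; [SchneiderStuhler1997, Ch. III §4]; [Brown1982, III §5–§6]).  `t = (P, M, N)` a parabolic
triple in a topological group `G` with `N` a union of compact open subgroups; `0 → M₁ →ᶠ M₀ →ᵍ V → 0` a short exact sequence of representations of `G` with `M₀` smooth, where `M₁`,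
`M₀` are BLOCK-PERMUTATION MODULES (★ FILE 3: blocks `W^q_b`, `b ∈ β_q`, permuted along `act_q`, `N`-orbit data `rep_q, tr_q, R_q`, heights `ht_q`) and a torus element `τ ∈ M`
shifts both heights by one; suppose the Jacquet module `V_N` is FINITE-DIMENSIONAL.  The Jacquet functor is exact (★ `jacquetMap_injective` ∕ `jacquetMap_exact` ∕
`jacquetMap_surjective`): `0 → (M₁)_N → (M₀)_N → V_N → 0`, and `r(τ) − 1` acts on it compatibly; by ★ FILE 3 `r(τ) − 1` is injective on `(M_q)_N` with cokernel of dimension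
`d_q := Σ_{r ∈ R_q, ht_q r = 0} dim W^q_r ⧸ K^q_r`; the snake lemma (★ 47a′ `LinearMap.finrank_quotient_range_eq_of_exact`: `0 → ker → coker₁ → coker₀ → coker_V → 0` with
`dim ker (r_V(τ) − 1) = dim coker (r_V(τ) − 1)` on the finite-dimensional `V_N`) gives **`d₁ = d₀`** (`sum_finrank_block_quotient_eq_of_shortExact`).  Model: the Schneider–Stuhler
resolution `0 → C₁(X) → C₀(X) → V → 0` of an admissible `V` on the Bruhat–Tits TREE of a rank-one group restricted to a minimal parabolic `B = T N` (★ 41d), `W^q_F ⧸ K^q_F =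
(V^{U_F})_{N ∩ P_F}`, one `q`-facet per `B`-orbit: `Σ_{F ∈ B∖X₁} dim (V^{U_F})_{N_F} = Σ_{F ∈ B∖X₀} dim (V^{U_F})_{N_F}`, i.e. the `B`-side Euler–Poincaré multiplicity of
`f_EP^{V,e}` vanishes — the (A3) input of `tr (i_B χ)(f_EP^{V,e}) = 0` (47d).

## References
* [BernsteinZelevinsky1976] I. N. Bernstein, A. V. Zelevinsky, *Representations of the group GL(n, F)…*, Russian Math. Surveys 31 (1976): §2.3, Prop. 2.35 (exactness of `V ↦ V_N`).
* [Casselman1995] W. Casselman, *Introduction to the theory of admissible representations of p-adic reductive groups*: §3.2 Thm. 3.2.3, §6.3.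
* [SchneiderStuhler1997] P. Schneider, U. Stuhler, *Representation theory and sheaves on the Bruhat–Tits building*, Publ. Math. IHÉS 85 (1997): Ch. II §3 (the resolution),
  Ch. III §4 (Euler–Poincaré functions).
* [Brown1982] K. S. Brown, *Cohomology of Groups* (1982): III §5–§6.
-/

set_option autoImplicit false

open scoped BigOperators DirectSum

namespace Representation

open Literature.NumberTheory.Automorphic

section Euler

variable {k G : Type*} [Field k] [CharZero k] [Group G] [TopologicalSpace G] [IsTopologicalGroup G] (t : ParabolicTriple G)
variable {M₁ M₀ V : Type*} [AddCommGroup M₁] [Module k M₁] [AddCommGroup M₀] [Module k M₀] [AddCommGroup V] [Module k V]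
variable {ρ₁ : Representation k G M₁} {ρ₀ : Representation k G M₀} {ρV : Representation k G V}
-- the short exact sequence and the topological input of Jacquet exactness
variable (hN : IsLimitOfCompactOpen t.N) (h₀ : ρ₀.IsSmooth) (f : ρ₁.IntertwiningMap ρ₀) (g : ρ₀.IntertwiningMap ρV)
  (hf : Function.Injective f) (hfg : Function.Exact f g) (hg : Function.Surjective g)
-- block data of `M₁`
variable {β₁ : Type*} [DecidableEq β₁] {Blk₁ : β₁ → Submodule k M₁} {act₁ : G → β₁ → β₁} (h₁ : DirectSum.IsInternal Blk₁)
  (hact₁ : ∀ g g' b, act₁ (g * g') b = act₁ g (act₁ g' b)) (hact1₁ : ∀ b, act₁ 1 b = b) (hperm₁ : ∀ g b m, m ∈ Blk₁ b → ρ₁ g m ∈ Blk₁ (act₁ g b))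
  {R₁ : Set β₁} (rep₁ : β₁ → β₁) (tr₁ : β₁ → G) (htrN₁ : ∀ b, tr₁ b ∈ t.N) (hrepR₁ : ∀ b, rep₁ b ∈ R₁) (htr₁ : ∀ b, act₁ (tr₁ b) (rep₁ b) = b)
  (hrep_act₁ : ∀ n ∈ t.N, ∀ b, rep₁ (act₁ n b) = rep₁ b) (hrep_id₁ : ∀ r ∈ R₁, rep₁ r = r) (ht₁ : β₁ → ℤ) (hfd₁ : ∀ b, FiniteDimensional k (Blk₁ b))
-- block data of `M₀`
variable {β₀ : Type*} [DecidableEq β₀] {Blk₀ : β₀ → Submodule k M₀} {act₀ : G → β₀ → β₀} (h₀' : DirectSum.IsInternal Blk₀)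
  (hact₀ : ∀ g g' b, act₀ (g * g') b = act₀ g (act₀ g' b)) (hact1₀ : ∀ b, act₀ 1 b = b) (hperm₀ : ∀ g b m, m ∈ Blk₀ b → ρ₀ g m ∈ Blk₀ (act₀ g b))
  {R₀ : Set β₀} (rep₀ : β₀ → β₀) (tr₀ : β₀ → G) (htrN₀ : ∀ b, tr₀ b ∈ t.N) (hrepR₀ : ∀ b, rep₀ b ∈ R₀) (htr₀ : ∀ b, act₀ (tr₀ b) (rep₀ b) = b)
  (hrep_act₀ : ∀ n ∈ t.N, ∀ b, rep₀ (act₀ n b) = rep₀ b) (hrep_id₀ : ∀ r ∈ R₀, rep₀ r = r) (ht₀ : β₀ → ℤ) (hfd₀ : ∀ b, FiniteDimensional k (Blk₀ b))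
-- the torus element, shifting both heights
variable {τ : G} (hτ : τ ∈ t.M) (hsh₁ : ∀ r ∈ R₁, ht₁ (rep₁ (act₁ τ r)) = ht₁ r + 1) (hsh₁' : ∀ r' ∈ R₁, ∃ r ∈ R₁, rep₁ (act₁ τ r) = r')
  (hsh₀ : ∀ r ∈ R₀, ht₀ (rep₀ (act₀ τ r)) = ht₀ r + 1) (hsh₀' : ∀ r' ∈ R₀, ∃ r ∈ R₀, rep₀ (act₀ τ r) = r')
-- finiteness of `V_N`
variable (hVN : FiniteDimensional k (t.restrict ρV).Coinvariants)

/-- **THE JACQUET IMAGE OF THE SEQUENCE AND THE ACTION OF `r(τ) − 1` ON IT** (★ exactness of `V ↦ V_N` + ★ functoriality): the linear maps `F = r(f)`, `G′ = r(g)` form a short exact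
sequence `0 → (M₁)_N → (M₀)_N → V_N → 0` and intertwine `r(τ) − 1`. [cite: BernsteinZelevinsky1976, §2.3, Prop. 2.35] [cite: Casselman1995, §3.2 Thm. 3.2.3] -/
theorem jacquetMap_shortExact_sub_id (hN : IsLimitOfCompactOpen t.N) (h₀ : ρ₀.IsSmooth) (f : ρ₁.IntertwiningMap ρ₀) (g : ρ₀.IntertwiningMap ρV)
    (hf : Function.Injective f) (hfg : Function.Exact f g) (hg : Function.Surjective g) (m : t.M) :
    Function.Injective (jacquetMap t f).toLinearMap ∧ Function.Exact (jacquetMap t f).toLinearMap (jacquetMap t g).toLinearMap ∧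
      Function.Surjective (jacquetMap t g).toLinearMap ∧
      (jacquetMap t f).toLinearMap ∘ₗ (ρ₁.jacquetModule t m - LinearMap.id : (t.restrict ρ₁).Coinvariants →ₗ[k] _) =
        (ρ₀.jacquetModule t m - LinearMap.id : (t.restrict ρ₀).Coinvariants →ₗ[k] _) ∘ₗ (jacquetMap t f).toLinearMap ∧
      (jacquetMap t g).toLinearMap ∘ₗ (ρ₀.jacquetModule t m - LinearMap.id : (t.restrict ρ₀).Coinvariants →ₗ[k] _) =
        (ρV.jacquetModule t m - LinearMap.id : (t.restrict ρV).Coinvariants →ₗ[k] _) ∘ₗ (jacquetMap t g).toLinearMap := by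
  refine ⟨jacquetMap_injective t hN h₀ f hf, jacquetMap_exact t f g hfg hg, jacquetMap_surjective t g hg, ?_, ?_⟩
  · refine LinearMap.ext fun x => ?_
    simp only [LinearMap.coe_comp, Function.comp_apply, LinearMap.sub_apply, LinearMap.id_apply, map_sub, IntertwiningMap.toLinearMap_apply]
    rw [(jacquetMap t f).isIntertwining]
  · refine LinearMap.ext fun x => ?_
    simp only [LinearMap.coe_comp, Function.comp_apply, LinearMap.sub_apply, LinearMap.id_apply, map_sub, IntertwiningMap.toLinearMap_apply]
    rw [(jacquetMap t g).isIntertwining]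

include hN h₀ hf hfg hg h₁ hact₁ hact1₁ hperm₁ htrN₁ hrepR₁ htr₁ hrep_act₁ hrep_id₁ hfd₁ h₀' hact₀ hact1₀ hperm₀ htrN₀ hrepR₀ htr₀ hrep_act₀ hrep_id₀ hfd₀ hτ hsh₁ hsh₁' hsh₀ hsh₀' hVN in
/-- **THE EULER IDENTITY `Σ_{r ∈ R₁, ht₁ r = 0} dim W¹_r ⧸ K¹_r = Σ_{r ∈ R₀, ht₀ r = 0} dim W⁰_r ⧸ K⁰_r`** for a short exact sequence `0 → M₁ → M₀ → V → 0` of representations of `G` (`M₀`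
smooth, `N` a union of compact open subgroups) by block-permutation modules whose heights the torus element `τ ∈ M` shifts, with `V_N` FINITE-DIMENSIONAL: Jacquet exactness (★), `r(τ) − 1`
injective with cokernel dimensions `d₁`, `d₀` (★ FILE 3), snake (★ 47a′). Model: `Σ_{F ∈ B∖X₁} dim (V^{U_F})_{N ∩ P_F} = Σ_{F ∈ B∖X₀} dim (V^{U_F})_{N ∩ P_F}` for the Schneider–Stuhler
resolution of an admissible `V` on a tree. [cite: SchneiderStuhler1997, Ch. III §4] [cite: BernsteinZelevinsky1976, §2.3, Prop. 2.35] [cite: Casselman1995, §6.3] -/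
theorem sum_finrank_block_quotient_eq_of_shortExact (S₁ : Finset β₁) (hS₁ : ∀ r, r ∈ S₁ ↔ r ∈ R₁ ∧ ht₁ r = 0) (S₀ : Finset β₀)
    (hS₀ : ∀ r, r ∈ S₀ ↔ r ∈ R₀ ∧ ht₀ r = 0) :
    ∑ r ∈ S₁, Module.finrank k (↥(Blk₁ r) ⧸ (Submodule.span k {x : M₁ | ∃ (s : G) (w : M₁), s ∈ t.N ∧ act₁ s r = r ∧ w ∈ Blk₁ r ∧ x = ρ₁ s w - w}).comap (Blk₁ r).subtype) =
      ∑ r ∈ S₀, Module.finrank k (↥(Blk₀ r) ⧸ (Submodule.span k {x : M₀ | ∃ (s : G) (w : M₀), s ∈ t.N ∧ act₀ s r = r ∧ w ∈ Blk₀ r ∧ x = ρ₀ s w - w}).comap (Blk₀ r).subtype) := by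
  haveI := hVN
  obtain ⟨hF, hFG, hG, hab, hbc⟩ := jacquetMap_shortExact_sub_id t hN h₀ f g hf hfg hg ⟨τ, hτ⟩
  rw [← finrank_quotient_range_jacquetModule_sub_id_eq_sum t h₁ hact₁ hact1₁ hperm₁ rep₁ tr₁ htrN₁ hrepR₁ htr₁ hrep_act₁ hrep_id₁ ht₁ hτ hsh₁ hsh₁' hfd₁ S₁ hS₁,
    ← finrank_quotient_range_jacquetModule_sub_id_eq_sum t h₀' hact₀ hact1₀ hperm₀ rep₀ tr₀ htrN₀ hrepR₀ htr₀ hrep_act₀ hrep_id₀ ht₀ hτ hsh₀ hsh₀' hfd₀ S₀ hS₀]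
  exact LinearMap.finrank_quotient_range_eq_of_exact _ _ hF hFG hG _ _ _ hab hbc
    (injective_jacquetModule_sub_id t h₀' hact₀ hact1₀ hperm₀ rep₀ tr₀ htrN₀ hrepR₀ htr₀ hrep_act₀ hrep_id₀ ht₀ hτ hsh₀ hsh₀')

end Euler

end Representation
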